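import Mathlib

/-!
# T⁴ programme, node NE3 — reading (F₀): SUP FROM MASS AND MODULUS on a lattice box («a Lipschitz grid function
# with small ℓ²-mass is small in sup», exponent `2∕(d+2)` after optimisation)

First generation of the NE3 prover lineage P3 of the cell `pub-balaban` (unit `b2b-balaban-t4-ne3-p3`; co-owner #3 of
`BINDER-OWNERS.md` row NE3).  Skeleton `HOME/t4/skeletons/NE3-t4-ne3-p3.md` leaf L12 (F₀) ∕ road P2's C-D «sup
readings»: the local ENERGY rate of the relative field (rate `L⁻¹`) becomes a SUP rate for the potential-level reading
(rate `L^{−1∕3}` in `d = 4`) through the elementary interpolation «Λ-Lipschitz at unit scale + ℓ²-mass `δ²` on a unit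
cube ⟹ sup ≲ (Λ^d δ²)^{1∕(d+2)}».  This file proves the COUNTING CORE of that step in the form the assembly consumes
(tree `T4ConvexResponse.localRate_of_interpolation`, p185646, takes the resulting inequality as its hypothesis `hI`):
on a box of `(k+1)^d` lattice points anchored at the point of interest, a lower modulus `|f x₀| − M ≤ |f y|` and a
weighted mass bound `w·Σ_{y ∈ box} f(y)² ≤ δ²` force `|f x₀| ≤ M + δ ∕ √(w·(k+1)^d)`.  Dictionary: `w = h^d` (cell
volume at mesh `h`), `M = Λ·d·k·h` (Lipschitz modulus along lattice paths inside the box), and the choice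
`h(k+1) ≍ (δ∕Λ)^{2∕(d+2)}` gives `sup ≲ (d+1)·Λ^{d∕(d+2)}·δ^{2∕(d+2)}` (real arithmetic left to the assembly, whose
exponent bookkeeping is the tree's `localRate_of_interpolation`); the existence of an inward box of side `k ≤ n∕2` at
every point of a cube of side `n` is the instantiation's (trivial) geometry.

HONEST FRAMING.  [folklore] counting∕real analysis; NOTHING about Bałaban's objects; no conditional of the cell;
NOT infinite volume, NOT a mass gap, NOT Clay, NOT summit progress.  PLACEMENT: our lemma under
`Summits/QuantumFields/BalabanUV/`; imports Mathlib only.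
-/

set_option autoImplicit false

open scoped BigOperators
open Finset

namespace Summit.QuantumFields.BalabanUV.T4Continuum.LatticeSupInterpolation

noncomputable section

variable {d : ℕ}

/-- The lattice box of `(k+1)^d` points anchored at `x₀`: `{y : x₀ ≤ y ≤ x₀ + k·𝟙}`. [folklore] -/
def anchoredBox (x₀ : Fin d → ℤ) (k : ℕ) : Finset (Fin d → ℤ) := Finset.Icc x₀ (x₀ + fun _ => (k : ℤ))

/-- The anchored box has exactly `(k+1)^d` points. [folklore] -/
theorem card_anchoredBox (x₀ : Fin d → ℤ) (k : ℕ) : (anchoredBox x₀ k).card = (k + 1) ^ d := by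
  unfold anchoredBox
  rw [Pi.card_Icc]
  have h : ∀ i : Fin d, (x₀ i + (k : ℤ) + 1 - x₀ i).toNat = k + 1 := fun i => by omega
  simp only [Pi.add_apply, Int.card_Icc, h, Finset.prod_const, Finset.card_univ, Fintype.card_fin]

/-- `x₀` lies in its anchored box. [folklore] -/
theorem self_mem_anchoredBox (x₀ : Fin d → ℤ) (k : ℕ) : x₀ ∈ anchoredBox x₀ k := by
  unfold anchoredBox
  rw [Finset.mem_Icc]
  refine ⟨le_rfl, fun i => ?_⟩
  simp only [Pi.add_apply, le_add_iff_nonneg_right]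
  positivity

/-- **SUP FROM MASS AND MODULUS (counting core).**  If `|f x₀| − M ≤ |f y|` for every `y` in a finite set `B ∋ x₀`
(a lower modulus of continuity from `x₀`), `0 ≤ M ≤ |f x₀|`, and the weighted mass `w·Σ_{y∈B} (f y)² ≤ δ²` with
`w > 0`, `δ ≥ 0`, then `(|f x₀| − M)·√(w·#B) ≤ δ`. [folklore] -/
theorem sub_modulus_mul_sqrt_le {ι : Type*} (B : Finset ι) (f : ι → ℝ) (x₀ : ι) {M w δ : ℝ}
    (hM : M ≤ |f x₀|) (hmod : ∀ y ∈ B, |f x₀| - M ≤ |f y|) (hw : 0 < w) (hδ : 0 ≤ δ)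
    (hmass : w * ∑ y ∈ B, f y ^ 2 ≤ δ ^ 2) :
    (|f x₀| - M) * Real.sqrt (w * B.card) ≤ δ := by
  have hs : 0 ≤ |f x₀| - M := by linarith
  -- each point of B carries at least (|f x₀| − M)²
  have h1 : (B.card : ℝ) * (|f x₀| - M) ^ 2 ≤ ∑ y ∈ B, f y ^ 2 := by
    have : ∑ _y ∈ B, (|f x₀| - M) ^ 2 ≤ ∑ y ∈ B, f y ^ 2 := by
      refine Finset.sum_le_sum fun y hy => ?_
      have h := hmod y hy
      calc (|f x₀| - M) ^ 2 ≤ |f y| ^ 2 := pow_le_pow_left₀ hs h 2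
        _ = f y ^ 2 := sq_abs _
    simpa [Finset.sum_const, nsmul_eq_mul] using this
  have h2 : ((|f x₀| - M) * Real.sqrt (w * B.card)) ^ 2 ≤ δ ^ 2 := by
    have hwB : 0 ≤ w * (B.card : ℝ) := by positivity
    calc ((|f x₀| - M) * Real.sqrt (w * B.card)) ^ 2 = (|f x₀| - M) ^ 2 * (w * B.card) := by
          rw [mul_pow, Real.sq_sqrt hwB]
      _ = w * ((B.card : ℝ) * (|f x₀| - M) ^ 2) := by ring
      _ ≤ w * ∑ y ∈ B, f y ^ 2 := mul_le_mul_of_nonneg_left h1 hw.le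
      _ ≤ δ ^ 2 := hmass
  exact pow_le_pow_iff_left₀ (by positivity) hδ two_ne_zero |>.mp h2

/-- **SUP FROM MASS AND MODULUS on the anchored box**: with `B = anchoredBox x₀ k` (so `#B = (k+1)^d`):
`|f x₀| ≤ M + δ ∕ √(w·(k+1)^d)` whenever the lower modulus holds on the box and `w·Σ_B f² ≤ δ²` (no sign or size
condition on `M` needed in this form). Dictionary: `w = h^d`, `M = Λ d k h`; optimise `k`. [folklore] -/
theorem abs_le_modulus_add_mass (x₀ : Fin d → ℤ) (k : ℕ) (f : (Fin d → ℤ) → ℝ) {M w δ : ℝ}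
    (hmod : ∀ y ∈ anchoredBox x₀ k, |f x₀| - M ≤ |f y|) (hw : 0 < w) (hδ : 0 ≤ δ)
    (hmass : w * ∑ y ∈ anchoredBox x₀ k, f y ^ 2 ≤ δ ^ 2) :
    |f x₀| ≤ M + δ / Real.sqrt (w * ((k : ℝ) + 1) ^ d) := by
  have hcard : ((anchoredBox x₀ k).card : ℝ) = ((k : ℝ) + 1) ^ d := by
    rw [card_anchoredBox]; push_cast; ring
  have hpos : 0 < Real.sqrt (w * ((k : ℝ) + 1) ^ d) := Real.sqrt_pos.mpr (by positivity)
  by_cases hM : M ≤ |f x₀|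
  · have h := sub_modulus_mul_sqrt_le (anchoredBox x₀ k) f x₀ hM hmod hw hδ hmass
    rw [hcard] at h
    have h' : |f x₀| - M ≤ δ / Real.sqrt (w * ((k : ℝ) + 1) ^ d) := (le_div_iff₀ hpos).mpr h
    linarith
  · have hM' : |f x₀| < M := not_le.mp hM
    have : 0 ≤ δ / Real.sqrt (w * ((k : ℝ) + 1) ^ d) := div_nonneg hδ hpos.le
    linarith

end

end Summit.QuantumFields.BalabanUV.T4Continuum.LatticeSupInterpolation
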